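import Summits.AtomisticToContinuum.BoseEinsteinCondensation.Theorems.BECThomsonPrincipleFibreConductanceStubLineFubini
import Summits.AtomisticToContinuum.BoseEinsteinCondensation.Theorems.BECThomsonPrincipleFibreConductanceStubFlatFlowDiv
import Summits.AtomisticToContinuum.BoseEinsteinCondensation.Theorems.BECThomsonPrincipleFibreConductanceStubFlatFlowCost
import Summits.AtomisticToContinuum.BoseEinsteinCondensation.Theorems.BECThomsonPrincipleFibreConductanceStubLineMoments
import Summits.AtomisticToContinuum.BoseEinsteinCondensation.Theorems.BECThomsonPrincipleFibreConductanceStubBetaHolder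
import Summits.AtomisticToContinuum.BoseEinsteinCondensation.Theorems.BECThomsonPrincipleFibreConductanceStubTransport
import Summits.AtomisticToContinuum.BoseEinsteinCondensation.Theorems.BECThomsonPrincipleFibreConductanceStubParsevalShell
import HarnessLib

/-!
# Route `BECThomsonPrinciple`, crux `FibreConductance` (stmt-AtomisticToContinuum-9480) —
# `FlatteningOfMoments` DISCHARGED: `ConditionalDensityMoments → DensityFlatteningCubic`

The gen-1 line `tagged-path-harnack-cage-moments` registered the stub
`stub_flatteningOfMoments : Goal.stub_flatteningOfMoments` (`= FlatteningOfMoments :=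
ConditionalDensityMoments → DensityFlatteningCubic`, `Theorems/…CageDefs.lean`) with a paper proof by
the ITERATED-PRIMITIVE FLOW. That proof is now in the tree as the flattening chain of the line
`parseval-shell-bootstrap` (r4): vocabulary and composition `densityFlatteningCubic_of`
(`…FlatteningDefs`, p121991) and the four deterministic stubs `stub_lineFubini` (p122731),
`stub_flatFlowDiv` (p122755), `stub_flatFlowCost` (p123024), `stub_lineMoments` (p123473). This file
records the discharge BY NAME for both lines:

* `TaggedPathHarnack.stub_flatteningOfMoments : Goal.stub_flatteningOfMoments` (gen-1's registered stub);
* `ParsevalShellBootstrap.densityFlatteningCubic_of_conditionalDensityMoments :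
  ConditionalDensityMoments → DensityFlatteningCubic` (the same implication under the r4 line's name);
* `ParsevalShellBootstrap.betaCorrectorBound_of_conditionalDensityMoments :
  ConditionalDensityMoments → ShellOccupation → BetaCorrectorBound` — the whole β-channel (density
  corrector) of the crux from the two shared open inputs (with gen-1's landed `stub_betaHolder`); this is
  the shared goal `BetaCorrectorBound` that line `healing-split-kinetic-defect` registers as
  `stub_betaCorrector`, reduced to the same two inputs.

* `ParsevalShellBootstrap.fibreConductance_of_three_inputs :
  GradientComparability → ConditionalDensityMoments → ShellOccupation → FibreConductance` — THE CRUX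
  FROM THREE NAMED OPEN INPUTS (the r4 skeleton's composition with every deterministic stub a theorem:
  `stub_transport`, `gradientCorrectorBound_of`, `stub_parsevalShell`, `stub_betaHolder`, the flattening
  chain). It supersedes gen-0's `fibreConductance_of_landscape_and_infrared` (p89995), whose middle
  hypothesis `DensityFlattening` (`E_W D² ≤ KL²`, hiding infrared screening of the density channel) is
  replaced by the weaker, k-free, shared `ConditionalDensityMoments`.

So the density channel of the crux (`BetaCorrectorBound`, via the landed `stub_betaHolder`) costs
exactly the shared k-free landscape input `ConditionalDensityMoments` plus the infrared input
`ShellOccupation`; no separate flattening item is needed at a re-cut, and the crux's residual open content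
is the triple (GradientComparability, ConditionalDensityMoments, ShellOccupation). [folklore]
-/

noncomputable section

namespace Summit.AtomisticToContinuum.BoseEinsteinCondensation.Cruxes.FibreConductance

open ParsevalShellBootstrap (densityFlatteningCubic_of stub_lineFubini stub_flatFlowDiv stub_flatFlowCost
  stub_lineMoments ShellOccupation BetaCorrectorBound GradientComparability stub_transport stub_parsevalShell
  gradientCorrectorBound_of)
open Summit.AtomisticToContinuum.BoseEinsteinCondensation.Theses.BECThomsonPrinciple (FibreConductance)

/-- **`ConditionalDensityMoments → DensityFlatteningCubic`** (the flattening chain of the line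
`parseval-shell-bootstrap`, composed): two-sided uniform-location moments of `g = L³ψ²` give a measurable
fibre flow flattening `ψ²` to `L⁻³` with `∫_{cellN} W·D³ ≤ K L⁹`. [folklore] -/
theorem ParsevalShellBootstrap.densityFlatteningCubic_of_conditionalDensityMoments :
    TaggedPathHarnack.ConditionalDensityMoments → TaggedPathHarnack.DensityFlatteningCubic :=
  densityFlatteningCubic_of stub_lineFubini stub_flatFlowDiv stub_flatFlowCost stub_lineMoments

/-- **The β-channel of the crux from the two shared open inputs**: `ConditionalDensityMoments →
ShellOccupation → BetaCorrectorBound` (flattening chain, then gen-1's Hölder `(3/2, 3)` step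
`stub_betaHolder`). [folklore] -/
theorem ParsevalShellBootstrap.betaCorrectorBound_of_conditionalDensityMoments :
    TaggedPathHarnack.ConditionalDensityMoments → ShellOccupation → BetaCorrectorBound :=
  fun hcdm => TaggedPathHarnack.stub_betaHolder
    (ParsevalShellBootstrap.densityFlatteningCubic_of_conditionalDensityMoments hcdm)

/-- **THE CRUX FROM THREE NAMED OPEN INPUTS**: `GradientComparability → ConditionalDensityMoments →
ShellOccupation → FibreConductance` — transport (`stub_transport`) + gradient corrector
(`gradientCorrectorBound_of`, `stub_parsevalShell`) + β-corrector from the two shared inputs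
(`betaCorrectorBound_of_conditionalDensityMoments`). Every deterministic step is a theorem in the tree;
the three hypotheses are the crux's residual open content. [folklore] -/
theorem ParsevalShellBootstrap.fibreConductance_of_three_inputs (hg : GradientComparability)
    (hcdm : TaggedPathHarnack.ConditionalDensityMoments) (hs : ShellOccupation) : FibreConductance :=
  stub_transport (gradientCorrectorBound_of hg (stub_parsevalShell hs))
    (ParsevalShellBootstrap.betaCorrectorBound_of_conditionalDensityMoments hcdm hs)

/-- **Registered stub `stub_flatteningOfMoments` of the line `tagged-path-harnack-cage-moments`,
DISCHARGED** (`Goal.stub_flatteningOfMoments = FlatteningOfMoments =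
ConditionalDensityMoments → DensityFlatteningCubic`). [folklore] -/
theorem TaggedPathHarnack.stub_flatteningOfMoments : TaggedPathHarnack.Goal.stub_flatteningOfMoments :=
  ParsevalShellBootstrap.densityFlatteningCubic_of_conditionalDensityMoments

end Summit.AtomisticToContinuum.BoseEinsteinCondensation.Cruxes.FibreConductance

end
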